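import Mathlib
import HarnessLib

/-!
# Far-side channel estimate: limits and the bookkeeping of constants

Analysis/PDE support file (everything proved, no definitions). Two small pieces of the far channel
estimate kept apart from the analysis:
* `ofReal_lim_le_liminf_affine`: if real numbers `I(t) → L` along a filter and eventually
  `ofReal (I t) ≤ 4 Φ t + 4 c₀` (`ℝ≥0∞`-valued `Φ`, `c₀ < ∞`), then `ofReal L ≤ 4 liminf Φ + 4 c₀`
  (the exact channel limits of the cut-off data against the true channel energies);
* `farStep_arith`: the final `ℝ≥0∞` arithmetic turning the data-side bound
  `D ≤ 3θ + 6(1+K_f)C_A(L⁺+L⁻) + 12 K_f C_c D_r/ρ` and the channel-side bounds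
  `ofReal L± ≤ 4Λ± + 4·ofReal(2θ + 32 A² C_c D_r/ρ)` into
  `ofReal D ≤ ofReal(C₁θ) + ofReal C₂ (Λ⁺ + Λ⁻) + ofReal(C₃ D_r/ρ)` with
  `C₁ = 3 + 96 C_A(1+K_f)`, `C₂ = 24 C_A (1+K_f)`, `C₃ = C_c (1536 C_A (1+K_f) A² + 12 K_f)`.
Route PhotonSphereChannels, `FixedModeChannels`, far side (stmt-FinalStateConjecture-10048).
Folklore.
-/

noncomputable section

namespace Literature.Analysis.PDE

open Filter Topology

/-- **Limits against `liminf`**: see the module docstring. [folklore] -/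
theorem ofReal_lim_le_liminf_affine {F : Filter ℝ} [F.NeBot] {I : ℝ → ℝ} {L : ℝ}
    {Φ : ℝ → ENNReal} {c₀ : ENNReal} (hI : Tendsto I F (𝓝 L))
    (hev : ∀ᶠ t in F, ENNReal.ofReal (I t) ≤ 4 * Φ t + 4 * c₀) :
    ENNReal.ofReal L ≤ 4 * liminf Φ F + 4 * c₀ := by
  have h1 : Tendsto (fun t => ENNReal.ofReal (I t)) F (𝓝 (ENNReal.ofReal L)) :=
    ENNReal.tendsto_ofReal hI
  rw [← h1.liminf_eq]
  have hmono : Monotone fun x : ENNReal => 4 * x + 4 * c₀ := fun x y hxy => by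
    dsimp only; gcongr
  have hcont : Continuous fun x : ENNReal => 4 * x + 4 * c₀ :=
    (ENNReal.continuous_const_mul (by norm_num)).add continuous_const
  have key : liminf (fun t => 4 * Φ t + 4 * c₀) F = 4 * liminf Φ F + 4 * c₀ :=
    (hmono.map_liminf_of_continuousAt (F := F) Φ hcont.continuousAt).symm
  calc liminf (fun t => ENNReal.ofReal (I t)) F ≤ liminf (fun t => 4 * Φ t + 4 * c₀) F :=
        liminf_le_liminf hev
    _ = 4 * liminf Φ F + 4 * c₀ := key

/-- The `ℝ≥0∞` core of the bookkeeping: from `D ≤ P + q(L⁺+L⁻)` and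
`ofReal L± ≤ 4Λ± + 4 ofReal c` to `ofReal D ≤ ofReal(P + 8qc) + ofReal(4q)(Λ⁺+Λ⁻)`. [folklore] -/
theorem farStep_arith_core {D P q Lp Lm c : ℝ} {Λp Λm : ENNReal} (hP : 0 ≤ P) (hq : 0 ≤ q)
    (hc : 0 ≤ c) (hLp : 0 ≤ Lp) (hLm : 0 ≤ Lm) (hD : D ≤ P + q * (Lp + Lm))
    (hp : ENNReal.ofReal Lp ≤ 4 * Λp + 4 * ENNReal.ofReal c)
    (hm : ENNReal.ofReal Lm ≤ 4 * Λm + 4 * ENNReal.ofReal c) :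
    ENNReal.ofReal D ≤ ENNReal.ofReal (P + 8 * q * c) + ENNReal.ofReal (4 * q) * (Λp + Λm) := by
  have h4 : ENNReal.ofReal 4 = (4 : ENNReal) := by norm_num
  have h8 : ENNReal.ofReal 8 = (8 : ENNReal) := by norm_num
  have step1 : ENNReal.ofReal D
      ≤ ENNReal.ofReal P + ENNReal.ofReal q * (ENNReal.ofReal Lp + ENNReal.ofReal Lm) := by
    calc ENNReal.ofReal D ≤ ENNReal.ofReal (P + q * (Lp + Lm)) := ENNReal.ofReal_le_ofReal hD
      _ = _ := by
          rw [ENNReal.ofReal_add hP (by positivity), ENNReal.ofReal_mul hq, ENNReal.ofReal_add hLp hLm]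
  have step2 : ENNReal.ofReal q * (ENNReal.ofReal Lp + ENNReal.ofReal Lm)
      ≤ ENNReal.ofReal q * ((4 * Λp + 4 * ENNReal.ofReal c) + (4 * Λm + 4 * ENNReal.ofReal c)) :=
    mul_le_mul' le_rfl (add_le_add hp hm)
  have e1 : ENNReal.ofReal (P + 8 * q * c) + ENNReal.ofReal (4 * q) * (Λp + Λm)
      = ENNReal.ofReal P + ENNReal.ofReal q
        * ((4 * Λp + 4 * ENNReal.ofReal c) + (4 * Λm + 4 * ENNReal.ofReal c)) := by
    rw [ENNReal.ofReal_add hP (by positivity), show 8 * q * c = q * c * 8 by ring,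
      ENNReal.ofReal_mul (by positivity : 0 ≤ q * c), ENNReal.ofReal_mul hq,
      show (4 : ℝ) * q = q * 4 by ring, ENNReal.ofReal_mul hq, h4, h8]
    ring
  rw [e1]
  exact step1.trans (add_le_add le_rfl step2)

/-- **The final bookkeeping of constants.** See the module docstring. [folklore] -/
theorem farStep_arith {D θ Dr ρ Lp Lm C_A Kf Cc A : ℝ} {Λp Λm : ENNReal}
    (hρ : 0 < ρ) (hθ : 0 ≤ θ) (hDr : 0 ≤ Dr) (hLp : 0 ≤ Lp) (hLm : 0 ≤ Lm) (hCA : 0 ≤ C_A)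
    (hKf : 0 ≤ Kf) (hCc : 0 ≤ Cc)
    (hD : D ≤ 3 * θ + 6 * (1 + Kf) * C_A * (Lp + Lm) + 12 * Kf * Cc * Dr / ρ)
    (hp : ENNReal.ofReal Lp ≤ 4 * Λp + 4 * ENNReal.ofReal (2 * θ + 32 * A ^ 2 * Cc * Dr / ρ))
    (hm : ENNReal.ofReal Lm ≤ 4 * Λm + 4 * ENNReal.ofReal (2 * θ + 32 * A ^ 2 * Cc * Dr / ρ)) :
    ENNReal.ofReal D ≤ ENNReal.ofReal ((3 + 96 * C_A * (1 + Kf)) * θ)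
      + ENNReal.ofReal (24 * C_A * (1 + Kf)) * (Λp + Λm)
      + ENNReal.ofReal (Cc * (1536 * C_A * (1 + Kf) * A ^ 2 + 12 * Kf) * Dr / ρ) := by
  have hD' : D ≤ (3 * θ + 12 * Kf * Cc * Dr / ρ) + (6 * (1 + Kf) * C_A) * (Lp + Lm) := by linarith
  have h := farStep_arith_core (by positivity) (by positivity) (by positivity) hLp hLm hD' hp hm
  have e1 : (3 * θ + 12 * Kf * Cc * Dr / ρ) + 8 * (6 * (1 + Kf) * C_A) * (2 * θ + 32 * A ^ 2 * Cc * Dr / ρ)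
      = (3 + 96 * C_A * (1 + Kf)) * θ + Cc * (1536 * C_A * (1 + Kf) * A ^ 2 + 12 * Kf) * Dr / ρ := by
    ring
  have e2 : 4 * (6 * (1 + Kf) * C_A) = 24 * C_A * (1 + Kf) := by ring
  rw [e1, e2, ENNReal.ofReal_add (by positivity) (by positivity)] at h
  calc ENNReal.ofReal D ≤ _ := h
    _ = _ := by ring

end Literature.Analysis.PDE
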